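import Mathlib.Topology.MetricSpace.HausdorffDimension
import Mathlib.Probability.ProductMeasure
import Mathlib.Probability.Distributions.Uniform
import Mathlib.Analysis.SpecificLimits.Normed
import Mathlib.Analysis.Normed.Group.InfiniteSum
import HarnessLib

/-!
# Self-similar Cantor dusts with a common ratio: the coding map and Moran's dimension bound

Support file (all results proved) for the barrier
`Literature.Barriers.NavierStokesRegularity.NavierStokesInequalityNearlyOneDimSingularSet`
(Scheffer 1987: weak solutions of the Navier–Stokes inequality whose singular set is a Cantor set
`S × {T₀}` with `dim_H S ≥ ξ`), whose last step is the classical lower bound for the Hausdorff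
dimension of a self-similar Cantor set (Scheffer 1987, Lemma 5.14, quoting Moran 1946, Thm. II;
Ożański 2017, Prop. 15, quoting Falconer, *Fractal geometry*, Example 4.5): for `M` similarities
`Γ_n(x) = τ x + d_n` of a real normed space with a COMMON ratio `τ ∈ (0,1)` and well separated
translations `d_n`, the attractor has Hausdorff dimension `log M / log τ⁻¹`; we prove the lower
bound in the form used there: `dim_H ≥ s` whenever `τ^s M ≥ 1`.

## Contents

* `CantorDust.word τ d m x = τ^j x + Σ_{k<j} τ^k d_{m_k}` — the composite similarity
  `Γ_m = Γ_{m_0} ∘ ⋯ ∘ Γ_{m_{j-1}}` of a word `m : Fin j → Fin M` (`word_cons`);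
  `CantorDust.level τ d G j = ⋃_{|m| = j} Γ_m(G)` (the `j`-th generation) and
  `CantorDust.limitSet τ d G = ⋂_j level j` (Ożański 2017, (6.4): `S = ⋂_j ⋃_{m ∈ M(j)} Γ_m(G)`).
* `CantorDust.code τ d ω = Σ_k τ^k d_{ω_k}` — the coding map `(ℕ → Fin M) → E`
  (`Γ_{ω|j}(x₀) → code ω`); `code_eq_word_code` (self-similarity
  `code ω = Γ_{ω|j}(code (σʲω))`), `code_mem` and `range_code_subset_limitSet`: for a closed
  nonempty `G` with `Γ_n(G) ⊆ G` the coded points lie in `⋂_j ⋃_m Γ_m(G)`.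
* `CantorDust.le_norm_code_sub_code`, `CantorDust.eq_of_dist_code_lt` — strong separation: if
  `‖d_n - d_{n'}‖ ≥ δ` for `n ≠ n'`, `‖d_n - d_{n'}‖ ≤ D` and `g := δ - τD/(1-τ) > 0`, two codes
  that first differ at place `k` are `≥ g τ^k` apart.
* `CantorDust.coinMeasure M` — the uniform Bernoulli measure on `ℕ → Fin M` (Mathlib
  `Measure.infinitePi` of the uniform `PMF` on `Fin M`); `coinMeasure_cylinder`: a cylinder of
  `k` prescribed letters has mass `M^{-k}`.
* `CantorDust.hausdorffMeasure_range_code_pos`, `CantorDust.le_dimH_range_code` — **Moran's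
  lower bound**: under strong separation, `0 < s`, `τ^s M ≥ 1` imply `μH[s](range code) > 0`,
  hence `s ≤ dim_H (range code)` (mass distribution principle: the image of the coin measure
  gives mass `≤ M^{-(k+1)} ≤ (diam U / g)^s` to any set `U` with `g τ^{k+1} ≤ diam U < g τ^k`;
  Mathlib's `OuterMeasure.le_mkMetric` is exactly the mass distribution principle, Falconer 4.2).

## Design

We work in a complete real normed space `E` (the application is `ℝ³`), with outer measures
(`OuterMeasure.map`), so that no measurability of the coding map is needed. The separation
hypothesis is the explicit numerical one above (for collinear equally spaced translations
`d_n = z + nXe`, `X > 0`, it reads `τ M < 1`, Ożański's (6.2)); the upper bound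
`dim_H ≤ log M / log τ⁻¹`, the open-set condition and unequal ratios (Moran's Thm. III,
Hutchinson 1981) are NOT treated.

## References

* P. A. P. Moran, *Additive functions of intervals and Hausdorff measure*, Proc. Cambridge
  Philos. Soc. 42 (1946), 15–23, Thms. II–III. [`Moran1946`]
* W. S. Ożański, arXiv:1709.00602, §6.1, Prop. 15 and (6.2)–(6.4). [`Ozanski2017NSISingular`]
* V. Scheffer, Comm. Math. Phys. 110 (1987), Lemma 5.14. [`Scheffer1987`]
* K. Falconer, *Fractal geometry*, 3rd ed. (2014), Example 4.5, Principle 4.2, Thm. 9.3.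
-/

noncomputable section

open Set Filter Function
open _root_.MeasureTheory _root_.MeasureTheory.Measure
open scoped ENNReal NNReal Topology

namespace Literature.MeasureTheory.Hausdorff

namespace CantorDust

variable {E : Type*} [NormedAddCommGroup E] [NormedSpace ℝ E]

/-- The composite similarity of the word `m = (m_0, …, m_{j-1})`:
`Γ_m = Γ_{m_0} ∘ ⋯ ∘ Γ_{m_{j-1}}`, `Γ_n(x) = τ x + d_n`, in closed form
`Γ_m(x) = τ^j x + Σ_{k<j} τ^k d_{m_k}` (Ożański 2017, §6.1: `π_m = β_{m_1} ∘ ⋯ ∘ β_{m_j}`,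
`Γ_m`). [cite: Ozanski2017NSISingular, §6.1] -/
def word (τ : ℝ) {M : ℕ} (d : Fin M → E) {j : ℕ} (m : Fin j → Fin M) (x : E) : E :=
  τ ^ j • x + ∑ k : Fin j, τ ^ (k : ℕ) • d (m k)

/-- The `j`-th generation `⋃_{m ∈ M(j)} Γ_m(G)` of the Cantor-dust construction started from `G`
(Ożański 2017, §6.1, the sets `C_j = ⋃_{m ∈ M(j)} π_m(I)` and `⋃_{m∈M(j)} Γ_m(G)`).
[cite: Ozanski2017NSISingular, §6.1] -/
def level (τ : ℝ) {M : ℕ} (d : Fin M → E) (G : Set E) (j : ℕ) : Set E :=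
  ⋃ m : Fin j → Fin M, word τ d m '' G

/-- The limit set `S = ⋂_{j ≥ 0} ⋃_{m ∈ M(j)} Γ_m(G)` (Ożański 2017, (6.4)); for `G` compact,
nonempty and invariant (`Γ_n(G) ⊆ G`) this is the attractor of the iterated function system
`{Γ_n}`. [cite: Ozanski2017NSISingular, §6.1 (6.4)] -/
def limitSet (τ : ℝ) {M : ℕ} (d : Fin M → E) (G : Set E) : Set E :=
  ⋂ j : ℕ, level τ d G j

/-- The **coding map** of the iterated function system `Γ_n(x) = τx + d_n`: the infinite word
`ω ∈ (Fin M)^ℕ` is sent to `Σ_k τ^k d_{ω_k} = lim_j Γ_{ω_0} ∘ ⋯ ∘ Γ_{ω_{j-1}}(x₀)` (any `x₀`).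
[folklore] -/
def code (τ : ℝ) {M : ℕ} (d : Fin M → E) (ω : ℕ → Fin M) : E :=
  ∑' k, τ ^ k • d (ω k)

variable {τ : ℝ} {M : ℕ} {d : Fin M → E} {G : Set E}

/-- The empty word acts as the identity. [folklore] -/
theorem word_zero (m : Fin 0 → Fin M) (x : E) : word τ d m x = x := by
  simp [word]

/-- `Γ_{(n, m)} = Γ_n ∘ Γ_m`. [folklore] -/
theorem word_cons {j : ℕ} (n : Fin M) (m : Fin j → Fin M) (x : E) :
    word τ d (Fin.cons n m : Fin (j + 1) → Fin M) x = τ • word τ d m x + d n := by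
  simp only [word, Fin.sum_univ_succ, Fin.cons_zero, Fin.cons_succ, Fin.val_zero, pow_zero,
    one_smul, Fin.val_succ, pow_succ', smul_add, Finset.smul_sum, smul_smul]
  abel

/-- If every `Γ_n` maps `G` into itself, so does every composite `Γ_m`. [folklore] -/
theorem mapsTo_word (hG : ∀ n, MapsTo (fun x => τ • x + d n) G G) :
    ∀ (j : ℕ) (m : Fin j → Fin M), MapsTo (word τ d m) G G
  | 0, m => fun x hx => by simpa [word_zero] using hx
  | j + 1, m => fun x hx => by
      rw [← Fin.cons_self_tail m, word_cons]
      exact hG (m 0) (mapsTo_word hG j (Fin.tail m) hx)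

/-- The generations stay inside an invariant `G`. [folklore] -/
theorem level_subset (hG : ∀ n, MapsTo (fun x => τ • x + d n) G G) (j : ℕ) :
    level τ d G j ⊆ G :=
  iUnion_subset fun m => (mapsTo_word hG j m).image_subset

/-- The limit set lies inside an invariant `G`. [folklore] -/
theorem limitSet_subset (hG : ∀ n, MapsTo (fun x => τ • x + d n) G G) :
    limitSet τ d G ⊆ G :=
  (iInter_subset _ 0).trans (level_subset hG 0)

omit [NormedSpace ℝ E] in
/-- A uniform bound for the translations. [folklore] -/
theorem norm_apply_le_sum (d : Fin M → E) (n : Fin M) : ‖d n‖ ≤ ∑ i, ‖d i‖ :=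
  Finset.single_le_sum (f := fun i => ‖d i‖) (fun _ _ => norm_nonneg _) (Finset.mem_univ n)

/-- The coding series converges absolutely (`0 ≤ τ < 1`). [folklore] -/
theorem summable_code [CompleteSpace E] (hτ₀ : 0 ≤ τ) (hτ₁ : τ < 1) (ω : ℕ → Fin M) :
    Summable fun k => τ ^ k • d (ω k) := by
  refine Summable.of_norm_bounded
    ((summable_geometric_of_lt_one hτ₀ hτ₁).mul_right (∑ i, ‖d i‖)) fun k => ?_
  rw [norm_smul, norm_pow, Real.norm_of_nonneg hτ₀]
  exact mul_le_mul_of_nonneg_left (norm_apply_le_sum d _) (pow_nonneg hτ₀ _)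

/-- **Self-similarity of the coding map**: `code ω = Γ_{ω|j}(code (σʲ ω))`, `σ` the shift.
[folklore] -/
theorem code_eq_word_code [CompleteSpace E] (hτ₀ : 0 ≤ τ) (hτ₁ : τ < 1) (ω : ℕ → Fin M)
    (j : ℕ) : code τ d ω = word τ d (fun k : Fin j => ω k) (code τ d fun k => ω (k + j)) := by
  have hs := summable_code (d := d) hτ₀ hτ₁ ω
  have hs' := summable_code (d := d) hτ₀ hτ₁ fun k => ω (k + j)
  rw [code, code, word, ← hs.sum_add_tsum_nat_add j,
    Fin.sum_univ_eq_sum_range (fun k => τ ^ k • d (ω k)) j, add_comm, ← hs'.tsum_const_smul]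
  congr 1
  refine tsum_congr fun i => ?_
  rw [smul_smul, ← pow_add, Nat.add_comm j i]

/-- Coded points lie in every closed nonempty invariant set `G`: `code ω = lim_j Γ_{ω|j}(x₀)`
with `x₀ ∈ G`, `Γ_{ω|j}(x₀) ∈ G`. [folklore] -/
theorem code_mem [CompleteSpace E] (hτ₀ : 0 ≤ τ) (hτ₁ : τ < 1) (hGc : IsClosed G)
    (hGn : G.Nonempty) (hG : ∀ n, MapsTo (fun x => τ • x + d n) G G) (ω : ℕ → Fin M) :
    code τ d ω ∈ G := by
  obtain ⟨x₀, hx₀⟩ := hGn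
  have hs := summable_code (d := d) hτ₀ hτ₁ ω
  have h1 : Tendsto (fun j : ℕ => τ ^ j • x₀) atTop (𝓝 0) := by
    simpa using (tendsto_pow_atTop_nhds_zero_of_lt_one hτ₀ hτ₁).smul_const x₀
  have h2 : Tendsto (fun j : ℕ => ∑ i ∈ Finset.range j, τ ^ i • d (ω i)) atTop
      (𝓝 (code τ d ω)) := hs.hasSum.tendsto_sum_nat
  have h3 : Tendsto (fun j : ℕ => word τ d (fun k : Fin j => ω k) x₀) atTop (𝓝 (code τ d ω)) := by
    have h := h1.add h2
    rw [zero_add] at h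
    refine h.congr fun j => ?_
    rw [word, Fin.sum_univ_eq_sum_range (fun k => τ ^ k • d (ω k)) j]
  exact hGc.mem_of_tendsto h3 (Eventually.of_forall fun j => mapsTo_word hG j _ hx₀)

/-- The coded points lie in the limit set `⋂_j ⋃_m Γ_m(G)` of any closed nonempty invariant
`G`. [folklore] -/
theorem range_code_subset_limitSet [CompleteSpace E] (hτ₀ : 0 ≤ τ) (hτ₁ : τ < 1)
    (hGc : IsClosed G) (hGn : G.Nonempty) (hG : ∀ n, MapsTo (fun x => τ • x + d n) G G) :
    range (code τ d) ⊆ limitSet τ d G := by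
  rintro _ ⟨ω, rfl⟩
  refine mem_iInter.2 fun j => mem_iUnion.2 ⟨fun k : Fin j => ω k, ?_⟩
  exact ⟨code τ d fun k => ω (k + j), code_mem hτ₀ hτ₁ hGc hGn hG _,
    (code_eq_word_code hτ₀ hτ₁ ω j).symm⟩

/-- **Strong separation.** If distinct translations are `≥ δ` apart and all are `≤ D` apart,
two codes that agree before place `k` and differ at place `k` are at distance
`≥ (δ - τD/(1-τ)) τ^k`: the `k`-th terms differ by `≥ δ τ^k`, the tails by
`≤ Σ_{i>k} τ^i D = τ^{k+1}D/(1-τ)`. [folklore] -/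
theorem le_norm_code_sub_code [CompleteSpace E] (hτ₀ : 0 ≤ τ) (hτ₁ : τ < 1) {δ D : ℝ}
    (hD : ∀ n n', ‖d n - d n'‖ ≤ D) (hδ : ∀ n n', n ≠ n' → δ ≤ ‖d n - d n'‖)
    {ω ω' : ℕ → Fin M} {k : ℕ} (hk : ω k ≠ ω' k) (hlt : ∀ i < k, ω i = ω' i) :
    (δ - τ * D / (1 - τ)) * τ ^ k ≤ ‖code τ d ω - code τ d ω'‖ := by
  set f : ℕ → E := fun i => τ ^ i • (d (ω i) - d (ω' i)) with hf
  have hB : ∀ i, ‖f i‖ ≤ τ ^ i * D := fun i => by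
    simp only [hf, norm_smul, norm_pow, Real.norm_of_nonneg hτ₀]
    exact mul_le_mul_of_nonneg_left (hD _ _) (pow_nonneg hτ₀ _)
  have hfs : Summable f :=
    Summable.of_norm_bounded ((summable_geometric_of_lt_one hτ₀ hτ₁).mul_right D) hB
  have hsub : code τ d ω - code τ d ω' = ∑' i, f i := by
    rw [code, code, ← (summable_code hτ₀ hτ₁ ω).tsum_sub (summable_code hτ₀ hτ₁ ω')]
    exact tsum_congr fun i => by simp [hf, smul_sub]
  have hzero : ∑ i ∈ Finset.range k, f i = 0 :=
    Finset.sum_eq_zero fun i hi => by simp [hf, hlt i (Finset.mem_range.1 hi)]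
  have hfs' : Summable fun i => f (i + k) := (summable_nat_add_iff k).2 hfs
  have hsplit : ∑' i, f i = f k + ∑' i, f (i + 1 + k) := by
    rw [← hfs.sum_add_tsum_nat_add k, hzero, zero_add, hfs'.tsum_eq_zero_add, zero_add]
  have h1τ : 0 < 1 - τ := sub_pos.2 hτ₁
  have htail_s : Summable fun i => τ ^ (i + 1 + k) * D := by
    refine ((summable_geometric_of_lt_one hτ₀ hτ₁).mul_left (τ ^ (k + 1) * D)).congr
      fun i => ?_
    ring
  have hn_s : Summable fun i => ‖f (i + 1 + k)‖ :=
    Summable.of_nonneg_of_le (fun _ => norm_nonneg _) (fun i => hB _) htail_s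
  have htail : ‖∑' i, f (i + 1 + k)‖ ≤ τ ^ (k + 1) * D / (1 - τ) :=
    calc ‖∑' i, f (i + 1 + k)‖ ≤ ∑' i, ‖f (i + 1 + k)‖ := norm_tsum_le_tsum_norm hn_s
      _ ≤ ∑' i, τ ^ (i + 1 + k) * D := Summable.tsum_le_tsum (fun i => hB _) hn_s htail_s
      _ = (∑' i : ℕ, τ ^ i) * (τ ^ (k + 1) * D) := by
          rw [← tsum_mul_right]
          exact tsum_congr fun i => by ring
      _ = τ ^ (k + 1) * D / (1 - τ) := by
          rw [tsum_geometric_of_lt_one hτ₀ hτ₁, inv_mul_eq_div]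
  have hhead : δ * τ ^ k ≤ ‖f k‖ := by
    simp only [hf, norm_smul, norm_pow, Real.norm_of_nonneg hτ₀]
    rw [mul_comm]
    exact mul_le_mul_of_nonneg_left (hδ _ _ hk) (pow_nonneg hτ₀ _)
  have hrev : ‖f k‖ - ‖∑' i, f (i + 1 + k)‖ ≤ ‖f k + ∑' i, f (i + 1 + k)‖ := by
    have h := norm_sub_le (f k + ∑' i, f (i + 1 + k)) (∑' i, f (i + 1 + k))
    rw [add_sub_cancel_right] at h
    linarith
  rw [hsub, hsplit]
  calc (δ - τ * D / (1 - τ)) * τ ^ k = δ * τ ^ k - τ ^ (k + 1) * D / (1 - τ) := by ring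
    _ ≤ ‖f k‖ - ‖∑' i, f (i + 1 + k)‖ := by linarith
    _ ≤ _ := hrev

/-- Consequently two codes at distance `< (δ - τD/(1-τ)) τ^k` agree up to place `k`.
[folklore] -/
theorem eq_of_dist_code_lt [CompleteSpace E] (hτ₀ : 0 ≤ τ) (hτ₁ : τ < 1) {δ D : ℝ}
    (hD : ∀ n n', ‖d n - d n'‖ ≤ D) (hδ : ∀ n n', n ≠ n' → δ ≤ ‖d n - d n'‖)
    {ω ω' : ℕ → Fin M} {k : ℕ}
    (h : dist (code τ d ω) (code τ d ω') < (δ - τ * D / (1 - τ)) * τ ^ k) :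
    ∀ i ≤ k, ω i = ω' i := by
  classical
  by_contra hcon
  push Not at hcon
  obtain ⟨i, hik, hi⟩ := hcon
  have hex : ∃ i, ω i ≠ ω' i := ⟨i, hi⟩
  have hspec : ω (Nat.find hex) ≠ ω' (Nat.find hex) := Nat.find_spec hex
  have hmin : ∀ i < Nat.find hex, ω i = ω' i := fun i hi => by
    simpa using Nat.find_min hex hi
  have hle_k : Nat.find hex ≤ k := (Nat.find_le hi).trans hik
  have hle := le_norm_code_sub_code hτ₀ hτ₁ hD hδ hspec hmin
  rw [← dist_eq_norm] at hle
  have hg : 0 < δ - τ * D / (1 - τ) := by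
    have h0 : 0 < (δ - τ * D / (1 - τ)) * τ ^ k := dist_nonneg.trans_lt h
    exact pos_of_mul_pos_left h0 (pow_nonneg hτ₀ _)
  have hpow : τ ^ k ≤ τ ^ Nat.find hex := pow_le_pow_of_le_one hτ₀ hτ₁.le hle_k
  have : (δ - τ * D / (1 - τ)) * τ ^ k ≤ dist (code τ d ω) (code τ d ω') :=
    (mul_le_mul_of_nonneg_left hpow hg.le).trans hle
  linarith

/-! ### The coin-tossing measure and Moran's lower bound -/

/-- The uniform Bernoulli (coin-tossing) probability measure on infinite words `ℕ → Fin M`: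
the infinite product of the uniform distribution on `Fin M` (Mathlib `Measure.infinitePi`).
[folklore] -/
def coinMeasure (M : ℕ) [NeZero M] : Measure (ℕ → Fin M) :=
  Measure.infinitePi fun _ : ℕ => (PMF.uniformOfFintype (Fin M)).toMeasure

/-- The coin-tossing measure is a probability measure (infinite product of probability
measures). [folklore] -/
instance coinMeasure.isProbabilityMeasure (M : ℕ) [NeZero M] :
    IsProbabilityMeasure (coinMeasure M) := by
  unfold coinMeasure
  infer_instance

/-- A cylinder with `k` prescribed letters has coin measure `M^{-k}`. [folklore] -/
theorem coinMeasure_cylinder (M : ℕ) [NeZero M] (ω₀ : ℕ → Fin M) (k : ℕ) :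
    coinMeasure M (Set.pi ↑(Finset.range k) fun i => {ω₀ i}) = ((M : ℝ≥0∞)⁻¹) ^ k := by
  rw [coinMeasure, Measure.infinitePi_pi _ (fun i _ => MeasurableSet.singleton (ω₀ i))]
  simp [PMF.uniformOfFintype_apply, Finset.prod_const, Finset.card_range]

/-- The image of the coin measure under the coding map, as an outer measure on `E` (no
measurability is needed). [folklore] -/
def codeOuterMeasure (τ : ℝ) {M : ℕ} [NeZero M] (d : Fin M → E) : OuterMeasure E :=
  OuterMeasure.map (code τ d) (coinMeasure M).toOuterMeasure

/-- The key covering estimate: a set of diameter `< (δ - τD/(1-τ)) τ^k` meets the coded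
points of at most one cylinder of `k+1` prescribed letters, so its image-measure is
`≤ M^{-(k+1)}`. [cite: Ozanski2017NSISingular, §6.1 Prop. 15] -/
theorem codeOuterMeasure_le_of_diam_lt [CompleteSpace E] [NeZero M] (hτ₀ : 0 ≤ τ) (hτ₁ : τ < 1)
    {δ D : ℝ} (hD : ∀ n n', ‖d n - d n'‖ ≤ D) (hδ : ∀ n n', n ≠ n' → δ ≤ ‖d n - d n'‖)
    {U : Set E} {k : ℕ}
    (hU : Metric.ediam U < ENNReal.ofReal ((δ - τ * D / (1 - τ)) * τ ^ k)) :
    codeOuterMeasure τ d U ≤ ((M : ℝ≥0∞)⁻¹) ^ (k + 1) := by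
  rw [codeOuterMeasure, OuterMeasure.map_apply]
  rcases (code τ d ⁻¹' U).eq_empty_or_nonempty with h0 | ⟨ω₀, hω₀⟩
  · simp [h0]
  have hsub : code τ d ⁻¹' U ⊆ Set.pi ↑(Finset.range (k + 1)) fun i => {ω₀ i} := by
    intro ω hω
    have hdist : dist (code τ d ω) (code τ d ω₀) < (δ - τ * D / (1 - τ)) * τ ^ k := by
      rw [← edist_lt_ofReal]
      exact (Metric.edist_le_ediam_of_mem (s := U) hω hω₀).trans_lt hU
    have heq := eq_of_dist_code_lt hτ₀ hτ₁ hD hδ hdist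
    simp only [Finset.coe_range, Set.mem_pi]
    exact fun i hi => heq i (Nat.lt_succ_iff.1 hi)
  calc (coinMeasure M).toOuterMeasure (code τ d ⁻¹' U)
      = coinMeasure M (code τ d ⁻¹' U) := rfl
    _ ≤ coinMeasure M (Set.pi ↑(Finset.range (k + 1)) fun i => {ω₀ i}) := measure_mono hsub
    _ = ((M : ℝ≥0∞)⁻¹) ^ (k + 1) := coinMeasure_cylinder M ω₀ (k + 1)

variable [MeasurableSpace E] [BorelSpace E]

/-- **Moran's lower bound (positivity of the Hausdorff measure).** Under strong separation
(`‖d_n - d_{n'}‖ ≥ δ` for `n ≠ n'`, `≤ D` always, `τD < δ(1-τ)`), if `0 < s` and `τ^s M ≥ 1`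
then `μH[s]` of the coded Cantor dust is positive: the image `μ` of the coin measure satisfies
`μ(U) ≤ g^{-s} (diam U)^s` for `diam U ≤ g/2`, `g = δ - τD/(1-τ)`, and `μ(range code) = 1`
(mass distribution principle; Moran 1946, Thm. II; Falconer, Example 4.5).
[cite: Moran1946, Thm. II] [cite: Ozanski2017NSISingular, §6.1 Prop. 15] -/
theorem hausdorffMeasure_range_code_pos [CompleteSpace E] (hτ₀ : 0 < τ) (hτ₁ : τ < 1)
    {δ D : ℝ} (hD : ∀ n n', ‖d n - d n'‖ ≤ D) (hδ : ∀ n n', n ≠ n' → δ ≤ ‖d n - d n'‖)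
    (hsep : τ * D < δ * (1 - τ)) {s : ℝ} (hs : 0 < s) (hsM : 1 ≤ τ ^ s * M) :
    0 < μH[s] (range (code τ d)) := by
  -- the gap constant
  set g : ℝ := δ - τ * D / (1 - τ) with hg_def
  have h1τ : 0 < 1 - τ := sub_pos.2 hτ₁
  have hg : 0 < g := by
    rw [hg_def, sub_pos, div_lt_iff₀ h1τ]
    exact hsep
  -- `M ≥ 2`, so `NeZero M` and `M⁻¹ < 1`
  have hτs : τ ^ s < 1 := Real.rpow_lt_one hτ₀.le hτ₁ hs
  have hM1 : (1 : ℝ) < M := by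
    by_contra hM
    push Not at hM
    have : τ ^ s * M < 1 := by
      calc τ ^ s * M ≤ τ ^ s * 1 :=
            mul_le_mul_of_nonneg_left hM (Real.rpow_nonneg hτ₀.le s)
        _ < 1 := by rw [mul_one]; exact hτs
    linarith
  haveI : NeZero M := ⟨fun h => by subst h; norm_num at hM1⟩
  have hM0 : (0 : ℝ) < M := by linarith
  have hMinv : (M : ℝ≥0∞)⁻¹ ≤ ENNReal.ofReal (τ ^ s) := by
    have h1 : (M : ℝ)⁻¹ ≤ τ ^ s := by
      rw [inv_le_iff_one_le_mul₀ hM0]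
      exact hsM
    calc (M : ℝ≥0∞)⁻¹ = ENNReal.ofReal ((M : ℝ)⁻¹) := by
          rw [ENNReal.ofReal_inv_of_pos hM0, ENNReal.ofReal_natCast]
      _ ≤ ENNReal.ofReal (τ ^ s) := ENNReal.ofReal_le_ofReal h1
  have hMinv_lt : (M : ℝ≥0∞)⁻¹ < 1 := by
    rw [ENNReal.inv_lt_one]
    exact_mod_cast hM1
  -- the estimate `g^s μ(U) ≤ (diam U)^s` for `diam U ≤ g/2`
  set μ : OuterMeasure E := codeOuterMeasure τ d with hμ
  have hest : ∀ U : Set E, Metric.ediam U ≤ ENNReal.ofReal (g / 2) →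
      (ENNReal.ofReal (g ^ s) • μ) U ≤ Metric.ediam U ^ s := by
    intro U hUle
    rw [_root_.smul_apply, smul_eq_mul]
    have htop : Metric.ediam U ≠ ⊤ := ne_top_of_le_ne_top ENNReal.ofReal_ne_top hUle
    set r : ℝ := (Metric.ediam U).toReal with hr
    have hr0 : 0 ≤ r := ENNReal.toReal_nonneg
    have hrt : Metric.ediam U = ENNReal.ofReal r := (ENNReal.ofReal_toReal htop).symm
    have hrg : r < g := by
      have : r ≤ g / 2 := by
        rw [hr, ← ENNReal.toReal_ofReal (by linarith : 0 ≤ g / 2)]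
        exact ENNReal.toReal_mono ENNReal.ofReal_ne_top hUle
      linarith
    rcases hr0.eq_or_lt with hr00 | hrpos
    · -- diameter zero: `μ U ≤ M^{-(k+1)}` for every `k`, hence `μ U = 0`
      have hμ0 : μ U = 0 := by
        refine le_antisymm (ge_of_tendsto' (ENNReal.tendsto_pow_atTop_nhds_zero_of_lt_one
          hMinv_lt) fun k => ?_) bot_le
        refine (codeOuterMeasure_le_of_diam_lt hτ₀.le hτ₁ hD hδ (k := k) ?_).trans
          (pow_le_pow_of_le_one bot_le hMinv_lt.le (Nat.le_succ k))
        rw [hrt, ← hr00, ENNReal.ofReal_zero]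
        exact ENNReal.ofReal_pos.2 (mul_pos hg (pow_pos hτ₀ k))
      rw [hμ0, mul_zero]
      exact bot_le
    · -- choose `k` with `g τ^{k+1} ≤ r < g τ^k`
      have hex : ∃ k : ℕ, g * τ ^ (k + 1) ≤ r := by
        have ht : Tendsto (fun k : ℕ => g * τ ^ (k + 1)) atTop (𝓝 (g * 0)) :=
          ((tendsto_pow_atTop_nhds_zero_of_lt_one hτ₀.le hτ₁).comp (tendsto_add_atTop_nat 1)
            ).const_mul g
        rw [mul_zero] at ht
        exact ((ht.eventually (gt_mem_nhds hrpos)).exists).imp fun k hk => hk.le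
      classical
      set k := Nat.find hex with hk
      have hk1 : g * τ ^ (k + 1) ≤ r := Nat.find_spec hex
      have hk2 : r < g * τ ^ k := by
        rcases Nat.eq_zero_or_pos k with hk0 | hkpos
        · rw [hk0, pow_zero, mul_one]; exact hrg
        · obtain ⟨k', hk'⟩ := Nat.exists_eq_succ_of_ne_zero hkpos.ne'
          have hmin := Nat.find_min hex (show k' < Nat.find hex by rw [← hk, hk']; exact Nat.lt_succ_self _)
          rw [hk']
          exact lt_of_not_ge hmin
      -- the measure bound
      have hμU : μ U ≤ ENNReal.ofReal ((r / g) ^ s) := by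
        have hlt : Metric.ediam U < ENNReal.ofReal ((δ - τ * D / (1 - τ)) * τ ^ k) := by
          rw [hrt, ← hg_def]
          exact (ENNReal.ofReal_lt_ofReal_iff (mul_pos hg (pow_pos hτ₀ k))).2 hk2
        calc μ U ≤ ((M : ℝ≥0∞)⁻¹) ^ (k + 1) := codeOuterMeasure_le_of_diam_lt hτ₀.le hτ₁ hD hδ hlt
          _ ≤ (ENNReal.ofReal (τ ^ s)) ^ (k + 1) := pow_le_pow_left' hMinv (k + 1)
          _ = ENNReal.ofReal ((τ ^ (k + 1)) ^ s) := by
              rw [← ENNReal.ofReal_pow (Real.rpow_nonneg hτ₀.le s), ← Real.rpow_natCast,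
                ← Real.rpow_mul hτ₀.le, mul_comm, Real.rpow_mul hτ₀.le, Real.rpow_natCast]
          _ ≤ ENNReal.ofReal ((r / g) ^ s) := by
              refine ENNReal.ofReal_le_ofReal (Real.rpow_le_rpow (pow_nonneg hτ₀.le _) ?_ hs.le)
              rw [le_div_iff₀ hg, mul_comm]
              exact hk1
      calc ENNReal.ofReal (g ^ s) * μ U
          ≤ ENNReal.ofReal (g ^ s) * ENNReal.ofReal ((r / g) ^ s) := mul_le_mul' le_rfl hμU
        _ = ENNReal.ofReal (r ^ s) := by
            rw [← ENNReal.ofReal_mul (Real.rpow_nonneg hg.le s), ← Real.mul_rpow hg.le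
              (div_nonneg hr0 hg.le), mul_div_cancel₀ _ hg.ne']
        _ = Metric.ediam U ^ s := by
            rw [hrt, ENNReal.ofReal_rpow_of_nonneg hr0 hs.le]
  -- mass distribution principle
  have hle : ENNReal.ofReal (g ^ s) • μ ≤ OuterMeasure.mkMetric fun r => r ^ s :=
    OuterMeasure.le_mkMetric _ _ (ENNReal.ofReal (g / 2))
      (ENNReal.ofReal_pos.2 (by linarith)) hest
  have hone : (ENNReal.ofReal (g ^ s) • μ) (range (code τ d)) = ENNReal.ofReal (g ^ s) := by
    rw [_root_.smul_apply, smul_eq_mul, hμ, codeOuterMeasure, OuterMeasure.map_apply]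
    have : code τ d ⁻¹' range (code τ d) = univ := eq_univ_of_forall fun ω => ⟨ω, rfl⟩
    rw [this]
    change ENNReal.ofReal (g ^ s) * coinMeasure M univ = _
    rw [measure_univ, mul_one]
  have hH : (OuterMeasure.mkMetric fun r : ℝ≥0∞ => r ^ s) (range (code τ d)) =
      μH[s] (range (code τ d)) := by
    rw [OuterMeasure.coe_mkMetric]
    rfl
  calc (0 : ℝ≥0∞) < ENNReal.ofReal (g ^ s) := ENNReal.ofReal_pos.2 (Real.rpow_pos_of_pos hg s)
    _ = (ENNReal.ofReal (g ^ s) • μ) (range (code τ d)) := hone.symm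
    _ ≤ (OuterMeasure.mkMetric fun r : ℝ≥0∞ => r ^ s) (range (code τ d)) := hle _
    _ = μH[s] (range (code τ d)) := hH

/-- **Moran's lower bound for the Hausdorff dimension of a self-similar Cantor dust** (Moran
1946, Thm. II; Falconer, Example 4.5; the form `τ^ξ M ≥ 1 ⇒ d_H(C) ≥ ξ` of Ożański 2017, §6.1,
Prop. 15 and (6.2); Scheffer 1987, Lemma 5.14): under strong separation, `0 ≤ s` and
`τ^s M ≥ 1` imply `s ≤ dim_H (range code)`.
[cite: Moran1946, Thm. II] [cite: Ozanski2017NSISingular, §6.1 Prop. 15] -/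
theorem le_dimH_range_code [CompleteSpace E] (hτ₀ : 0 < τ) (hτ₁ : τ < 1) {δ D : ℝ}
    (hD : ∀ n n', ‖d n - d n'‖ ≤ D) (hδ : ∀ n n', n ≠ n' → δ ≤ ‖d n - d n'‖)
    (hsep : τ * D < δ * (1 - τ)) {s : ℝ} (hs : 0 ≤ s) (hsM : 1 ≤ τ ^ s * M) :
    ENNReal.ofReal s ≤ dimH (range (code τ d)) := by
  rcases hs.eq_or_lt with rfl | hs'
  · simp
  have h := hausdorffMeasure_range_code_pos hτ₀ hτ₁ hD hδ hsep hs' hsM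
  have h' : μH[((s.toNNReal : ℝ≥0) : ℝ)] (range (code τ d)) ≠ 0 := by
    rw [Real.coe_toNNReal _ hs]
    exact h.ne'
  exact le_dimH_of_hausdorffMeasure_ne_zero h'

end CantorDust

end Literature.MeasureTheory.Hausdorff
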